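import Mathlib
import Summits.Ventures.PercRepro2.HalfLA2BMassesA
import Summits.Ventures.PercRepro2.HalfLA2OPoly

/-!
# The masses of the `L`-half for `a₃ ~ {a₂, o}` in the ten cells (blind cell PercRepro2, night-1 g37)

`a₃` adjacent exactly to the root `a₂` (edge `e₁`, weight `r₁`) and to `o` (edge `e₂`, weight `r₂`):
`CaseOne.IsTwoMarkAt ends a₂ o a₃ e₁ e₂` (p1's structure with `o := a₂`, `b := o`).  With `e₁` open `a₃ ∈ H`
on `Q₀`, with `e₂` open `a₃` is a leaf at `o`, with both open `o`'s cluster joins `H` through `a₃` and `Q`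
becomes `Q₀ ∩ {o ∉ L}`.  The cells are `HalfLA2B.cells10Of`; the masses are the polynomials of
`HalfLA2OPoly`.
-/

namespace Summit.Ventures.PercRepro2

namespace HalfLA2O

open CaseOne HalfLTwoMark HalfLA2B

section Masses

variable {V : Type*} {E : Type*} [Fintype E] [DecidableEq E] {R : Type*} [CommRing R]
variable {ends : E → Sym2 V} {o a₃ b : V} {e₁ e₂ : E}

/-- The ten cells (the `Cells10` of `HalfLA2OPoly` from the base probabilities of `HalfLA2B.cells10Of`). -/
noncomputable def cellsA2O (p : E → R) (ends : E → Sym2 V) (o a₁ a₂ b : V) (e₁ e₂ : E) : Cells10 R :=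
  ⟨(cells10Of p ends o a₁ a₂ b e₁ e₂).LL, (cells10Of p ends o a₁ a₂ b e₁ e₂).LH,
    (cells10Of p ends o a₁ a₂ b e₁ e₂).LN, (cells10Of p ends o a₁ a₂ b e₁ e₂).HL,
    (cells10Of p ends o a₁ a₂ b e₁ e₂).HH, (cells10Of p ends o a₁ a₂ b e₁ e₂).HN,
    (cells10Of p ends o a₁ a₂ b e₁ e₂).NL, (cells10Of p ends o a₁ a₂ b e₁ e₂).NH,
    (cells10Of p ends o a₁ a₂ b e₁ e₂).NNs, (cells10Of p ends o a₁ a₂ b e₁ e₂).NNd⟩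


/-- **`P(Q)`** for `a₃ ~ {a₂, o}`. -/
theorem mass_Q (p : E → R) {a₁ a₂ : V} (h : IsTwoMarkAt ends a₂ o a₃ e₁ e₂) (h1 : a₁ ≠ a₃)
    (_hb3 : b ≠ a₃) :
    prob p ((connEvent ends a₁ a₂)ᶜ) =
      mQ (p e₁) (p e₂) (cellsA2O p ends o a₁ a₂ b e₁ e₂) := by
  set p00 := Function.update (Function.update p e₁ 0) e₂ 0 with hp00
  have h2 : a₂ ≠ a₃ := h.ne_o
  have ho3 : o ≠ a₃ := h.ne_b
  have key := prob_twoPin p h.ne ((connEvent ends a₁ a₂)ᶜ)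
    ((connEvent ends a₁ a₂)ᶜ ∩ (connEvent ends a₁ o)ᶜ)
    ((connEvent ends a₁ a₂)ᶜ)
    ((connEvent ends a₁ a₂)ᶜ)
    ((connEvent ends a₁ a₂)ᶜ) ?_ ?_ ?_ ?_
  · rw [key]
    unfold mQ cellsA2O cells10Of
    dsimp only
    rw [← hp00]
    have c := prob_inter_add_prob_inter_compl p00 (connEvent ends a₁ a₂)ᶜ (connEvent ends a₁ o)
    have sb := split_b p00 ends b a₁ a₂ (connEvent ends a₁ o)
    have tot := total_cells p00 ends o b a₁ a₂
    have nn := split_NN p00 ends o a₁ a₂ b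
    linear_combination (p e₁ * p e₂) * (c - sb) + tot + nn
  · intro ω ho hb
    rw [openCC_tt ho hb]
    simp only [Set.mem_compl_iff, Set.mem_inter_iff, mem_connEvent]
    rw [conn_both_iff h ω h1 h2,
      base2_eq_self ho hb]
    simp only [conn_comm_iff ω o a₂]
    have haa := conn_refl ends ω a₂
    have hoo := conn_refl ends ω o
    tauto
  · intro ω ho hb
    rw [openCC_tf h.ne ho hb]
    simp only [Set.mem_compl_iff, mem_connEvent]
    rw [conn_open_o_iff h ω h1 h2, base2_eq_self ho hb]

  · intro ω ho hb
    rw [openCC_ft ho hb]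
    simp only [Set.mem_compl_iff, mem_connEvent]
    rw [conn_open_b_iff h ω h1 h2, base2_eq_self ho hb]

  · intro ω ho hb
    rw [openCC_ff ho hb, base2_eq_self ho hb]


/-- **`P(Q, b ∈ L)`** for `a₃ ~ {a₂, o}`. -/
theorem mass_bL (p : E → R) {a₁ a₂ : V} (h : IsTwoMarkAt ends a₂ o a₃ e₁ e₂) (h1 : a₁ ≠ a₃)
    (hb3 : b ≠ a₃) :
    prob p ((connEvent ends a₁ a₂)ᶜ ∩ connEvent ends a₁ b) =
      mbL (p e₁) (p e₂) (cellsA2O p ends o a₁ a₂ b e₁ e₂) := by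
  set p00 := Function.update (Function.update p e₁ 0) e₂ 0 with hp00
  have h2 : a₂ ≠ a₃ := h.ne_o
  have ho3 : o ≠ a₃ := h.ne_b
  have key := prob_twoPin p h.ne ((connEvent ends a₁ a₂)ᶜ ∩ connEvent ends a₁ b)
    ((connEvent ends a₁ a₂)ᶜ ∩ (connEvent ends a₁ o)ᶜ ∩ connEvent ends a₁ b)
    ((connEvent ends a₁ a₂)ᶜ ∩ connEvent ends a₁ b)
    ((connEvent ends a₁ a₂)ᶜ ∩ connEvent ends a₁ b)
    ((connEvent ends a₁ a₂)ᶜ ∩ connEvent ends a₁ b) ?_ ?_ ?_ ?_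
  · rw [key]
    unfold mbL cellsA2O cells10Of
    dsimp only
    rw [← hp00]
    have so := split_o p00 ends o a₁ a₂ (connEvent ends a₁ b)
    have e : prob p00 ((connEvent ends a₁ a₂)ᶜ ∩ (connEvent ends a₁ o)ᶜ ∩ connEvent ends a₁ b) =
        prob p00 ((connEvent ends a₁ a₂)ᶜ ∩ connEvent ends a₁ b) - prob p00 ((connEvent ends a₁ a₂)ᶜ ∩ connEvent ends a₁ o ∩ connEvent ends a₁ b) := by
      have c := prob_inter_add_prob_inter_compl p00 ((connEvent ends a₁ a₂)ᶜ ∩ connEvent ends a₁ b) (connEvent ends a₁ o)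
      have e1 : (connEvent ends a₁ a₂)ᶜ ∩ connEvent ends a₁ b ∩ connEvent ends a₁ o = (connEvent ends a₁ a₂)ᶜ ∩ connEvent ends a₁ o ∩ connEvent ends a₁ b := Set.inter_right_comm _ _ _
      have e2 : (connEvent ends a₁ a₂)ᶜ ∩ connEvent ends a₁ b ∩ (connEvent ends a₁ o)ᶜ = (connEvent ends a₁ a₂)ᶜ ∩ (connEvent ends a₁ o)ᶜ ∩ connEvent ends a₁ b := Set.inter_right_comm _ _ _
      rw [e1, e2] at c
      linear_combination c
    rw [e]
    linear_combination so
  · intro ω ho hb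
    rw [openCC_tt ho hb]
    simp only [Set.mem_compl_iff, Set.mem_inter_iff, mem_connEvent]
    rw [conn_both_iff h ω h1 h2, conn_both_iff h ω h1 hb3,
      base2_eq_self ho hb]
    simp only [conn_comm_iff ω o a₂, conn_comm_iff ω o b]
    have haa := conn_refl ends ω a₂
    have hoo := conn_refl ends ω o
    tauto
  · intro ω ho hb
    rw [openCC_tf h.ne ho hb]
    simp only [Set.mem_compl_iff, Set.mem_inter_iff, mem_connEvent]
    rw [conn_open_o_iff h ω h1 h2, conn_open_o_iff h ω h1 hb3, base2_eq_self ho hb]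

  · intro ω ho hb
    rw [openCC_ft ho hb]
    simp only [Set.mem_compl_iff, Set.mem_inter_iff, mem_connEvent]
    rw [conn_open_b_iff h ω h1 h2, conn_open_b_iff h ω h1 hb3, base2_eq_self ho hb]

  · intro ω ho hb
    rw [openCC_ff ho hb, base2_eq_self ho hb]


/-- **`P(T)`** for `a₃ ~ {a₂, o}`. -/
theorem mass_T (p : E → R) {a₁ a₂ : V} (h : IsTwoMarkAt ends a₂ o a₃ e₁ e₂) (h1 : a₁ ≠ a₃)
    (_hb3 : b ≠ a₃) :
    prob p ((connEvent ends a₁ a₂)ᶜ ∩ connEvent ends a₂ a₃) =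
      mT (p e₁) (p e₂) (cellsA2O p ends o a₁ a₂ b e₁ e₂) := by
  set p00 := Function.update (Function.update p e₁ 0) e₂ 0 with hp00
  have h2 : a₂ ≠ a₃ := h.ne_o
  have ho3 : o ≠ a₃ := h.ne_b
  have key := prob_twoPin p h.ne ((connEvent ends a₁ a₂)ᶜ ∩ connEvent ends a₂ a₃)
    ((connEvent ends a₁ a₂)ᶜ ∩ (connEvent ends a₁ o)ᶜ)
    ((connEvent ends a₁ a₂)ᶜ)
    ((connEvent ends a₁ a₂)ᶜ ∩ connEvent ends a₂ o)
    (∅) ?_ ?_ ?_ ?_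
  · rw [key]
    unfold mT cellsA2O cells10Of
    dsimp only
    rw [← hp00, prob_empty]
    have c := prob_inter_add_prob_inter_compl p00 (connEvent ends a₁ a₂)ᶜ (connEvent ends a₁ o)
    have sb := split_b p00 ends b a₁ a₂ (connEvent ends a₁ o)
    have sb2 := split_b p00 ends b a₁ a₂ (connEvent ends a₂ o)
    have tot := total_cells p00 ends o b a₁ a₂
    have nn := split_NN p00 ends o a₁ a₂ b
    linear_combination (p e₁ * p e₂) * (c - sb) + ((1 - p e₁) * p e₂) * sb2 + p e₁ * (tot + nn)
  · intro ω ho hb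
    rw [openCC_tt ho hb]
    simp only [Set.mem_compl_iff, Set.mem_inter_iff, mem_connEvent]
    rw [conn_both_iff h ω h1 h2, conn_both_a3_iff h ω h2,
      base2_eq_self ho hb]
    simp only [conn_comm_iff ω o a₂]
    have haa := conn_refl ends ω a₂
    have hoo := conn_refl ends ω o
    tauto
  · intro ω ho hb
    rw [openCC_tf h.ne ho hb]
    simp only [Set.mem_compl_iff, Set.mem_inter_iff, mem_connEvent]
    rw [conn_open_o_iff h ω h1 h2, conn_open_o_a3_iff h ω h2, base2_eq_self ho hb]
    have haa := conn_refl ends ω a₂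
    tauto
  · intro ω ho hb
    rw [openCC_ft ho hb]
    simp only [Set.mem_compl_iff, Set.mem_inter_iff, mem_connEvent]
    rw [conn_open_b_iff h ω h1 h2, conn_open_b_a3_iff h ω h2, base2_eq_self ho hb]

  · intro ω ho hb
    rw [openCC_ff ho hb]
    simp only [Set.mem_compl_iff, Set.mem_inter_iff, mem_connEvent, Set.mem_empty_iff_false,
      iff_false]
    exact fun hc => not_conn_base2 h ω h2 hc.2


/-- **`P(T, b ∈ L)`** for `a₃ ~ {a₂, o}`. -/
theorem mass_TbL (p : E → R) {a₁ a₂ : V} (h : IsTwoMarkAt ends a₂ o a₃ e₁ e₂) (h1 : a₁ ≠ a₃)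
    (hb3 : b ≠ a₃) :
    prob p ((connEvent ends a₁ a₂)ᶜ ∩ connEvent ends a₂ a₃ ∩ connEvent ends a₁ b) =
      mTbL (p e₁) (p e₂) (cellsA2O p ends o a₁ a₂ b e₁ e₂) := by
  set p00 := Function.update (Function.update p e₁ 0) e₂ 0 with hp00
  have h2 : a₂ ≠ a₃ := h.ne_o
  have ho3 : o ≠ a₃ := h.ne_b
  have key := prob_twoPin p h.ne ((connEvent ends a₁ a₂)ᶜ ∩ connEvent ends a₂ a₃ ∩ connEvent ends a₁ b)
    ((connEvent ends a₁ a₂)ᶜ ∩ (connEvent ends a₁ o)ᶜ ∩ connEvent ends a₁ b)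
    ((connEvent ends a₁ a₂)ᶜ ∩ connEvent ends a₁ b)
    ((connEvent ends a₁ a₂)ᶜ ∩ connEvent ends a₂ o ∩ connEvent ends a₁ b)
    (∅) ?_ ?_ ?_ ?_
  · rw [key]
    unfold mTbL cellsA2O cells10Of
    dsimp only
    rw [← hp00, prob_empty]
    have so := split_o p00 ends o a₁ a₂ (connEvent ends a₁ b)
    have e : prob p00 ((connEvent ends a₁ a₂)ᶜ ∩ (connEvent ends a₁ o)ᶜ ∩ connEvent ends a₁ b) =
        prob p00 ((connEvent ends a₁ a₂)ᶜ ∩ connEvent ends a₁ b) - prob p00 ((connEvent ends a₁ a₂)ᶜ ∩ connEvent ends a₁ o ∩ connEvent ends a₁ b) := by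
      have c := prob_inter_add_prob_inter_compl p00 ((connEvent ends a₁ a₂)ᶜ ∩ connEvent ends a₁ b) (connEvent ends a₁ o)
      have e1 : (connEvent ends a₁ a₂)ᶜ ∩ connEvent ends a₁ b ∩ connEvent ends a₁ o = (connEvent ends a₁ a₂)ᶜ ∩ connEvent ends a₁ o ∩ connEvent ends a₁ b := Set.inter_right_comm _ _ _
      have e2 : (connEvent ends a₁ a₂)ᶜ ∩ connEvent ends a₁ b ∩ (connEvent ends a₁ o)ᶜ = (connEvent ends a₁ a₂)ᶜ ∩ (connEvent ends a₁ o)ᶜ ∩ connEvent ends a₁ b := Set.inter_right_comm _ _ _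
      rw [e1, e2] at c
      linear_combination c
    rw [e]
    linear_combination (p e₁ * p e₂) * so + (p e₁ * (1 - p e₂)) * so
  · intro ω ho hb
    rw [openCC_tt ho hb]
    simp only [Set.mem_compl_iff, Set.mem_inter_iff, mem_connEvent]
    rw [conn_both_iff h ω h1 h2, conn_both_iff h ω h1 hb3, conn_both_a3_iff h ω h2,
      base2_eq_self ho hb]
    simp only [conn_comm_iff ω o a₂, conn_comm_iff ω o b]
    have haa := conn_refl ends ω a₂
    have hoo := conn_refl ends ω o
    tauto
  · intro ω ho hb
    rw [openCC_tf h.ne ho hb]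
    simp only [Set.mem_compl_iff, Set.mem_inter_iff, mem_connEvent]
    rw [conn_open_o_iff h ω h1 h2, conn_open_o_iff h ω h1 hb3, conn_open_o_a3_iff h ω h2, base2_eq_self ho hb]
    have haa := conn_refl ends ω a₂
    tauto
  · intro ω ho hb
    rw [openCC_ft ho hb]
    simp only [Set.mem_compl_iff, Set.mem_inter_iff, mem_connEvent]
    rw [conn_open_b_iff h ω h1 h2, conn_open_b_iff h ω h1 hb3, conn_open_b_a3_iff h ω h2, base2_eq_self ho hb]

  · intro ω ho hb
    rw [openCC_ff ho hb]
    simp only [Set.mem_compl_iff, Set.mem_inter_iff, mem_connEvent, Set.mem_empty_iff_false,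
      iff_false]
    exact fun hc => not_conn_base2 h ω h2 hc.1.2


/-- **`P(T, b ∈ L, o ∈ U)`** for `a₃ ~ {a₂, o}`. -/
theorem mass_TbLoU (p : E → R) {a₁ a₂ : V} (h : IsTwoMarkAt ends a₂ o a₃ e₁ e₂) (h1 : a₁ ≠ a₃)
    (hb3 : b ≠ a₃) :
    prob p ((connEvent ends a₁ a₂)ᶜ ∩ connEvent ends a₂ a₃ ∩ connEvent ends a₁ b ∩ (connEvent ends a₁ o ∪ connEvent ends a₂ o)) =
      mTbLoU (p e₁) (p e₂) (cellsA2O p ends o a₁ a₂ b e₁ e₂) := by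
  set p00 := Function.update (Function.update p e₁ 0) e₂ 0 with hp00
  have h2 : a₂ ≠ a₃ := h.ne_o
  have ho3 : o ≠ a₃ := h.ne_b
  have key := prob_twoPin p h.ne ((connEvent ends a₁ a₂)ᶜ ∩ connEvent ends a₂ a₃ ∩ connEvent ends a₁ b ∩ (connEvent ends a₁ o ∪ connEvent ends a₂ o))
    ((connEvent ends a₁ a₂)ᶜ ∩ (connEvent ends a₁ o)ᶜ ∩ connEvent ends a₁ b)
    (((connEvent ends a₁ a₂)ᶜ ∩ connEvent ends a₁ o ∩ connEvent ends a₁ b) ∪ ((connEvent ends a₁ a₂)ᶜ ∩ connEvent ends a₂ o ∩ connEvent ends a₁ b))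
    ((connEvent ends a₁ a₂)ᶜ ∩ connEvent ends a₂ o ∩ connEvent ends a₁ b)
    (∅) ?_ ?_ ?_ ?_
  · rw [key]
    unfold mTbLoU cellsA2O cells10Of
    dsimp only
    rw [← hp00, prob_empty]
    have d : Disjoint ((connEvent ends a₁ a₂)ᶜ ∩ connEvent ends a₁ o ∩ connEvent ends a₁ b) ((connEvent ends a₁ a₂)ᶜ ∩ connEvent ends a₂ o ∩ connEvent ends a₁ b) :=
      Set.disjoint_left.2 fun ω h1 h2 => not_both h1.1.1 h1.1.2 h2.1.2
    rw [prob_union_of_disjoint p00 d]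
    have so := split_o p00 ends o a₁ a₂ (connEvent ends a₁ b)
    have e : prob p00 ((connEvent ends a₁ a₂)ᶜ ∩ (connEvent ends a₁ o)ᶜ ∩ connEvent ends a₁ b) =
        prob p00 ((connEvent ends a₁ a₂)ᶜ ∩ connEvent ends a₁ b) - prob p00 ((connEvent ends a₁ a₂)ᶜ ∩ connEvent ends a₁ o ∩ connEvent ends a₁ b) := by
      have c := prob_inter_add_prob_inter_compl p00 ((connEvent ends a₁ a₂)ᶜ ∩ connEvent ends a₁ b) (connEvent ends a₁ o)
      have e1 : (connEvent ends a₁ a₂)ᶜ ∩ connEvent ends a₁ b ∩ connEvent ends a₁ o = (connEvent ends a₁ a₂)ᶜ ∩ connEvent ends a₁ o ∩ connEvent ends a₁ b := Set.inter_right_comm _ _ _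
      have e2 : (connEvent ends a₁ a₂)ᶜ ∩ connEvent ends a₁ b ∩ (connEvent ends a₁ o)ᶜ = (connEvent ends a₁ a₂)ᶜ ∩ (connEvent ends a₁ o)ᶜ ∩ connEvent ends a₁ b := Set.inter_right_comm _ _ _
      rw [e1, e2] at c
      linear_combination c
    rw [e]
    linear_combination (p e₁ * p e₂) * so
  · intro ω ho hb
    rw [openCC_tt ho hb]
    simp only [Set.mem_compl_iff, Set.mem_inter_iff, Set.mem_union, mem_connEvent]
    rw [conn_both_iff h ω h1 h2, conn_both_iff h ω h1 hb3, conn_both_iff h ω h1 ho3, conn_both_iff h ω h2 ho3, conn_both_a3_iff h ω h2,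
      base2_eq_self ho hb]
    simp only [conn_comm_iff ω o a₂, conn_comm_iff ω o b]
    have haa := conn_refl ends ω a₂
    have hoo := conn_refl ends ω o
    tauto
  · intro ω ho hb
    rw [openCC_tf h.ne ho hb]
    simp only [Set.mem_compl_iff, Set.mem_inter_iff, Set.mem_union, mem_connEvent]
    rw [conn_open_o_iff h ω h1 h2, conn_open_o_iff h ω h1 hb3, conn_open_o_iff h ω h1 ho3, conn_open_o_iff h ω h2 ho3, conn_open_o_a3_iff h ω h2, base2_eq_self ho hb]
    have haa := conn_refl ends ω a₂
    tauto
  · intro ω ho hb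
    rw [openCC_ft ho hb]
    simp only [Set.mem_compl_iff, Set.mem_inter_iff, Set.mem_union, mem_connEvent]
    rw [conn_open_b_iff h ω h1 h2, conn_open_b_iff h ω h1 hb3, conn_open_b_iff h ω h1 ho3, conn_open_b_iff h ω h2 ho3, conn_open_b_a3_iff h ω h2, base2_eq_self ho hb]
    tauto
  · intro ω ho hb
    rw [openCC_ff ho hb]
    simp only [Set.mem_compl_iff, Set.mem_inter_iff, Set.mem_union, mem_connEvent, Set.mem_empty_iff_false,
      iff_false]
    exact fun hc => not_conn_base2 h ω h2 hc.1.1.2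


end Masses

end HalfLA2O

end Summit.Ventures.PercRepro2
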